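import Mathlib
import Literature.NumberTheory.LFunctions.Zhang2022.Section12Ded1217Splits
import HarnessLib

/-!
# Zhang (2022) §12, discharge layer III: the size of `S_j(𝐚₁₅,𝐚₂₂)`, `E(𝐚₁₅,𝐚₂₂) = o(𝔓)`

Topic `Literature/NumberTheory/LFunctions/Zhang2022` (Landau–Siegel audit tree; verdict-neutral).
Y. Zhang, *Discrete mean estimates and the Landau–Siegel zero*, arXiv:2211.02515v1 (2022)
[Zhang2022LandauSiegel]. **Status of the source: an unrefereed manuscript under adjudication** (campaign D-0069, cell
siegel-zhang). Everything in this file is PROVED (theorems only; no new definitions, no new facts);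
nothing here is a claim about Theorems 1–2 of the source or about Landau–Siegel zeros.

Third of four files discharging `Z22:(12.17)` / `Skeleton.Ded1217 c′` from the typed §12 nodes. The
p. 73 evaluation of `S_j(𝐚₁₅,𝐚₂₂)` over `P″₁ < dr < P₂` (`Typed.Sec12C.Step12u049`, second form) carries
`D`-dependent integrals `∫𝔤𝔥_{jμ}(θ−z)𝓦*⁰_j(P^z)dz`; here they are bounded UNIFORMLY in `D`:

| decl | content | locator |
|---|---|---|
| `norm_ghF_le`, `norm_ghj_le` | `|𝔤𝔥_{jμ}(z)| ≤ 7` on `|z| ≤ 1` (closed forms (8.13)–(8.18), `π < 4`) | §8 p. 48 |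
| `log_rpow_div_P1pp`, `abs_log_rpow_div_P1pp_le` | `log(P^z/P″₁) = (z−0.496)log P − 𝓛 − 519 log 𝓛`, `≤ 0.004 log P + 520𝓛` in size | §12 p. 67 |
| `norm_frakwStar0_le` | `|𝓦*⁰_j(P^z)| ≤ 1 + (6+15|c′|π)·521π` on `[0.496, 0.5]`, uniformly in `D` | §12 p. 73 |
| `norm_int049_le`, `int_norm_ghj_le`, `norm_main12u049int_le`, `maj12u049int_le` | the u049 main term and slack carrier are `O(α𝔞)` | §12 p. 73 |
| `norm_Sj_a15_le` | `S_j(𝐚₁₅,𝐚₂₂) = O(α𝔞) + O(α)` ⇐ `Low1522`, `Step12u049` | §12 p. 73 |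
| `ecal_a15_small` | **`E(𝐚₁₅,𝐚₂₂) = o(𝔓)`** ⇐ `Low1522`, `Step12u049` — TACIT input of "by Proposition 7.1", derived | §12 p. 73; §7 Prop. 7.1 |

## References

* Y. Zhang, arXiv:2211.02515v1 (2022), §12 p. 73, (12.16); §8 (8.13)–(8.18) p. 48; §7 Prop. 7.1.
  [cite: Zhang2022LandauSiegel, §12 (12.16)]
-/

noncomputable section

open Complex Real ComplexConjugate
open Literature.NumberTheory.LFunctions.Zhang2022
open Literature.NumberTheory.LFunctions.Zhang2022.Skeleton
open Literature.NumberTheory.LFunctions.Zhang2022.Typed.Sec12A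
open Literature.NumberTheory.LFunctions.Zhang2022.Typed.Sec12C

namespace Literature.NumberTheory.LFunctions.Zhang2022.Sec12D

/-! ## The size of `S_j(𝐚₁₅,𝐚₂₂)` from the p. 73 range claims; `E(𝐚₁₅,𝐚₂₂) = o(𝔓)` -/

section SizeA15

variable (c' : ℝ) {D : ℕ} [NeZero D] (χ : DirichletCharacter ℂ D)

/-- `|𝔤𝔥| ≤ 7` on `|z| ≤ 1` for the generic profile `r₀ + (r₁ + bπiz)e^{−kπiz}` whenever
`|r₀| + |r₁| + |b|π ≤ 7`. [cite: Zhang2022LandauSiegel, §8 (8.13)–(8.18) p.48] -/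
theorem norm_ghF_le (r0 r1 b k : ℚ) {z : ℝ} (hz : |z| ≤ 1)
    (hc : |(r0 : ℝ)| + |(r1 : ℝ)| + |(b : ℝ)| * π ≤ 7) : ‖ghF r0 r1 b k z‖ ≤ 7 := by
  have hπ := Real.pi_pos
  have hexp : ‖cexp (-((k : ℂ) * π * I * z))‖ = 1 := by
    have : (-((k : ℂ) * π * I * z)) = ((-((k : ℝ) * π * z) : ℝ) : ℂ) * I := by push_cast; ring
    rw [this, Complex.norm_exp_ofReal_mul_I]
  have h0 : ‖(r0 : ℂ)‖ = |(r0 : ℝ)| := by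
    rw [show (r0 : ℂ) = ((r0 : ℝ) : ℂ) by push_cast; rfl, Complex.norm_real, Real.norm_eq_abs]
  have h1 : ‖(r1 : ℂ) + (b : ℂ) * π * I * z‖ ≤ |(r1 : ℝ)| + |(b : ℝ)| * π := by
    calc ‖(r1 : ℂ) + (b : ℂ) * π * I * z‖ ≤ ‖(r1 : ℂ)‖ + ‖(b : ℂ) * π * I * z‖ := norm_add_le _ _
      _ = |(r1 : ℝ)| + |(b : ℝ)| * π * |z| := by
          rw [show (r1 : ℂ) = ((r1 : ℝ) : ℂ) by push_cast; rfl,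
            show (b : ℂ) = ((b : ℝ) : ℂ) by push_cast; rfl]
          rw [norm_mul, norm_mul, norm_mul, Complex.norm_real, Complex.norm_real, Complex.norm_real,
            Complex.norm_I, Complex.norm_real]
          simp only [Real.norm_eq_abs, abs_of_pos hπ]
          ring
      _ ≤ |(r1 : ℝ)| + |(b : ℝ)| * π * 1 := by gcongr
      _ = |(r1 : ℝ)| + |(b : ℝ)| * π := by ring
  rw [ghF]
  calc ‖(r0 : ℂ) + ((r1 : ℂ) + (b : ℂ) * π * I * z) * cexp (-((k : ℂ) * π * I * z))‖
      ≤ ‖(r0 : ℂ)‖ + ‖((r1 : ℂ) + (b : ℂ) * π * I * z) * cexp (-((k : ℂ) * π * I * z))‖ :=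
        norm_add_le _ _
    _ = |(r0 : ℝ)| + ‖(r1 : ℂ) + (b : ℂ) * π * I * z‖ := by rw [norm_mul, hexp, mul_one, h0]
    _ ≤ |(r0 : ℝ)| + (|(r1 : ℝ)| + |(b : ℝ)| * π) := by gcongr
    _ ≤ 7 := by linarith

/-- **`|𝔤𝔥_{jμ}(z)| ≤ 7`** for `|z| ≤ 1`, `j ∈ {1,2,3}`, `μ ∈ {6,7}` ((8.13)–(8.18), `π < 4`).
[cite: Zhang2022LandauSiegel, §8 (8.13)–(8.18) p.48] -/
theorem norm_ghj_le {j μ : ℕ} (hj : j ∈ ({1, 2, 3} : Finset ℕ)) (hμ : μ ∈ ({6, 7} : Finset ℕ))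
    {z : ℝ} (hz : |z| ≤ 1) : ‖ghj j μ z‖ ≤ 7 := by
  have hπ := Real.pi_lt_four
  have hπ0 := Real.pi_pos
  simp only [Finset.mem_insert, Finset.mem_singleton] at hj hμ
  rcases hj with rfl | rfl | rfl <;> rcases hμ with rfl | rfl
  · simp only [ghj, gh16]; exact norm_ghF_le _ _ _ _ hz (by norm_num [abs_of_pos hπ0]; nlinarith)
  · simp only [ghj, gh17]; exact norm_ghF_le _ _ _ _ hz (by norm_num [abs_of_pos hπ0]; nlinarith)
  · simp only [ghj, gh26]; exact norm_ghF_le _ _ _ _ hz (by norm_num [abs_of_pos hπ0]; nlinarith)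
  · simp only [ghj, gh27]; exact norm_ghF_le _ _ _ _ hz (by norm_num [abs_of_pos hπ0]; nlinarith)
  · simp only [ghj, gh36]; exact norm_ghF_le _ _ _ _ hz (by norm_num [abs_of_pos hπ0]; nlinarith)
  · simp only [ghj, gh37]; exact norm_ghF_le _ _ _ _ hz (by norm_num [abs_of_pos hπ0]; nlinarith)

omit [NeZero D] in
/-- `log(P^z/P″₁) = (z − 0.496)log P − 𝓛 − 519 log 𝓛`. [cite: Zhang2022LandauSiegel, §12 p. 67] -/
theorem log_rpow_div_P1pp (hD : 1 ≤ Real.log D) (z : ℝ) :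
    Real.log (bigP D ^ z / P1pp D) =
      (z - 0.496) * Real.log (bigP D) - ell D - 519 * Real.log (ell D) := by
  have hP := Skeleton.bigP_pos D
  have hD0 := natCast_pos_of_one_le_log hD
  have hℓ : 0 < ell D := by rw [ell]; linarith
  have ht : 0 < t0 D := by rw [t0]; exact pow_pos hℓ _
  rw [Real.log_div (Real.rpow_pos_of_pos hP z).ne' (P1pp_pos hD).ne', Real.log_rpow hP, P1pp,
    Real.log_mul (by positivity) ht.ne', Real.log_mul (Real.rpow_pos_of_pos hP _).ne' hD0.ne',
    Real.log_rpow hP, t0, Real.log_pow, ← ell]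
  push_cast
  ring

omit [NeZero D] in
/-- `|log(P^z/P″₁)| ≤ 0.004 log P + 520𝓛` for `z ∈ [0.496, 0.5]`. [cite: Zhang2022LandauSiegel, §12 p. 67] -/
theorem abs_log_rpow_div_P1pp_le (hD : 1 ≤ Real.log D) {z : ℝ} (hz1 : 0.496 ≤ z) (hz2 : z ≤ 0.5) :
    |Real.log (bigP D ^ z / P1pp D)| ≤ 0.004 * Real.log (bigP D) + 520 * ell D := by
  have hℓ1 : 1 ≤ ell D := by rw [ell]; exact hD
  have hlogP : 0 ≤ Real.log (bigP D) := by rw [Skeleton.log_bigP]; positivity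
  have hlogℓ0 : 0 ≤ Real.log (ell D) := Real.log_nonneg hℓ1
  have hlogℓ : Real.log (ell D) ≤ ell D := by
    have := Real.log_le_sub_one_of_pos (by linarith : 0 < ell D); linarith
  rw [log_rpow_div_P1pp hD, abs_le]
  constructor <;> nlinarith

omit [NeZero D] in
/-- **`|𝓦*⁰_j(P^z)| ≤ W(c′)`** uniformly in `D` (`𝓛 ≥ 1`) for `z ∈ [0.496, 0.5]`, with
`W(c′) = 1 + (6 + 15|c′|π)·521π` (`‖2β₆ − β_j‖ ≤ α(6 + 15|c′|π)`, `α log P = π`, `α𝓛 ≤ π`).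
[cite: Zhang2022LandauSiegel, §12 (12.16) p.73] -/
theorem norm_frakwStar0_le (hD : 1 ≤ Real.log D) (j : ℕ) {z : ℝ} (hz1 : 0.496 ≤ z) (hz2 : z ≤ 0.5) :
    ‖frakwStar0 c' D j (bigP D ^ z)‖ ≤ 1 + (6 + 15 * |c'| * π) * (521 * π) := by
  have hπ := Real.pi_pos
  have hα := alpha_pos_of_log hD
  have hαP := alpha_mul_logP (D := D) hD
  have hαℓ := alpha_mul_ell_le (D := D) hD
  have hlogP : 0 ≤ Real.log (bigP D) := by rw [Skeleton.log_bigP]; exact pow_nonneg (by rw [ell]; linarith) _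
  have hℓ0 : 0 ≤ ell D := by rw [ell]; linarith
  have hβ6 := (norm_beta67 (D := D) hD).1
  have hβj := norm_betaJ_le c' hD j
  have hcoef : ‖2 * beta6 D - betaJ c' D j‖ ≤ alpha D * (6 + 15 * |c'| * π) := by
    calc ‖2 * beta6 D - betaJ c' D j‖ ≤ ‖2 * beta6 D‖ + ‖betaJ c' D j‖ := norm_sub_le _ _
      _ ≤ 2 * (3 * alpha D / 2) + 3 * alpha D * (1 + 5 * |c'| * π) := by
          rw [norm_mul, Complex.norm_two, hβ6]; linarith
      _ = alpha D * (6 + 15 * |c'| * π) := by ring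
  have hlog := abs_log_rpow_div_P1pp_le (D := D) hD hz1 hz2
  rw [frakwStar0]
  calc ‖-1 + (2 * beta6 D - betaJ c' D j) * (Real.log (bigP D ^ z / P1pp D) : ℂ)‖
      ≤ ‖(-1 : ℂ)‖ + ‖(2 * beta6 D - betaJ c' D j) * (Real.log (bigP D ^ z / P1pp D) : ℂ)‖ :=
        norm_add_le _ _
    _ = 1 + ‖2 * beta6 D - betaJ c' D j‖ * |Real.log (bigP D ^ z / P1pp D)| := by
        rw [norm_neg, norm_one, norm_mul, Complex.norm_real, Real.norm_eq_abs]
    _ ≤ 1 + alpha D * (6 + 15 * |c'| * π) * (0.004 * Real.log (bigP D) + 520 * ell D) := by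
        gcongr
    _ = 1 + (6 + 15 * |c'| * π) * (0.004 * (alpha D * Real.log (bigP D)) +
          520 * (alpha D * ell D)) := by ring
    _ ≤ 1 + (6 + 15 * |c'| * π) * (0.004 * π + 520 * π) := by rw [hαP]; gcongr
    _ = 1 + (6 + 15 * |c'| * π) * (520.004 * π) := by ring
    _ ≤ 1 + (6 + 15 * |c'| * π) * (521 * π) := by gcongr; norm_num

omit [NeZero D] in
/-- The two integrals of u049 (second form) are `O(1)` uniformly in `D`:
`‖∫_{0.496}^{0.498}𝔤𝔥_{j6}(0.498−z)𝓦*⁰_j(P^z)dz‖ ≤ 7W·0.002`, `‖∫_{0.496}^{0.5}𝔤𝔥_{j7}(0.5−z)𝓦*⁰_j(P^z)dz‖ ≤ 7W·0.004`.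
[cite: Zhang2022LandauSiegel, §12 (12.16) p.73] -/
theorem norm_int049_le (hD : 1 ≤ Real.log D) {j : ℕ} (hj : j ∈ ({1, 2, 3} : Finset ℕ)) :
    ‖∫ z in (0.496:ℝ)..0.498, ghj j 6 (0.498 - z) * frakwStar0 c' D j (bigP D ^ z)‖ ≤
        7 * (1 + (6 + 15 * |c'| * π) * (521 * π)) * 0.002 ∧
      ‖∫ z in (0.496:ℝ)..0.5, ghj j 7 (0.5 - z) * frakwStar0 c' D j (bigP D ^ z)‖ ≤
        7 * (1 + (6 + 15 * |c'| * π) * (521 * π)) * 0.004 := by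
  have hW : 0 ≤ 1 + (6 + 15 * |c'| * π) * (521 * π) := by positivity
  constructor
  · have h := intervalIntegral.norm_integral_le_of_norm_le_const (a := (0.496:ℝ)) (b := 0.498)
      (C := 7 * (1 + (6 + 15 * |c'| * π) * (521 * π)))
      (f := fun z => ghj j 6 (0.498 - z) * frakwStar0 c' D j (bigP D ^ z)) (fun x hx => by
        rw [Set.uIoc_of_le (by norm_num)] at hx
        obtain ⟨hx1, hx2⟩ := hx
        rw [norm_mul]
        exact mul_le_mul (norm_ghj_le hj (by simp) (by rw [abs_le]; constructor <;> linarith))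
          (norm_frakwStar0_le c' hD j (by linarith) (by linarith)) (norm_nonneg _) (by norm_num))
    refine h.trans (le_of_eq ?_)
    norm_num
  · have h := intervalIntegral.norm_integral_le_of_norm_le_const (a := (0.496:ℝ)) (b := 0.5)
      (C := 7 * (1 + (6 + 15 * |c'| * π) * (521 * π)))
      (f := fun z => ghj j 7 (0.5 - z) * frakwStar0 c' D j (bigP D ^ z)) (fun x hx => by
        rw [Set.uIoc_of_le (by norm_num)] at hx
        obtain ⟨hx1, hx2⟩ := hx
        rw [norm_mul]
        exact mul_le_mul (norm_ghj_le hj (by simp) (by rw [abs_le]; constructor <;> linarith))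
          (norm_frakwStar0_le c' hD j (by linarith) (by linarith)) (norm_nonneg _) (by norm_num))
    refine h.trans (le_of_eq ?_)
    norm_num

omit [NeZero D] in
/-- The majorant integrals of u049: `∫_{0.496}^{0.498}‖𝔤𝔥_{j6}(0.498−z)‖dz ≤ 7·0.002`,
`∫_{0.496}^{0.5}‖𝔤𝔥_{j7}(0.5−z)‖dz ≤ 7·0.004`. [cite: Zhang2022LandauSiegel, §12 (12.16) p.73] -/
theorem int_norm_ghj_le {j : ℕ} (hj : j ∈ ({1, 2, 3} : Finset ℕ)) :
    (∫ z in (0.496:ℝ)..0.498, ‖ghj j 6 (0.498 - z)‖) ≤ 7 * 0.002 ∧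
      (∫ z in (0.496:ℝ)..0.5, ‖ghj j 7 (0.5 - z)‖) ≤ 7 * 0.004 := by
  constructor
  · have h := intervalIntegral.norm_integral_le_of_norm_le_const (a := (0.496:ℝ)) (b := 0.498)
      (C := 7) (f := fun z => ‖ghj j 6 (0.498 - z)‖) (fun x hx => by
        rw [Set.uIoc_of_le (by norm_num)] at hx
        obtain ⟨hx1, hx2⟩ := hx
        rw [norm_norm]
        exact norm_ghj_le hj (by simp) (by rw [abs_le]; constructor <;> linarith))
    rw [Real.norm_eq_abs] at h
    refine (le_abs_self _).trans (h.trans (le_of_eq ?_))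
    norm_num
  · have h := intervalIntegral.norm_integral_le_of_norm_le_const (a := (0.496:ℝ)) (b := 0.5)
      (C := 7) (f := fun z => ‖ghj j 7 (0.5 - z)‖) (fun x hx => by
        rw [Set.uIoc_of_le (by norm_num)] at hx
        obtain ⟨hx1, hx2⟩ := hx
        rw [norm_norm]
        exact norm_ghj_le hj (by simp) (by rw [abs_le]; constructor <;> linarith))
    rw [Real.norm_eq_abs] at h
    refine (le_abs_self _).trans (h.trans (le_of_eq ?_))
    norm_num

end SizeA15

section SizeA15b

variable (c' : ℝ) {D : ℕ} [NeZero D] (χ : DirichletCharacter ℂ D)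

omit [NeZero D] in
/-- `log P = π/α`. [cite: Zhang2022LandauSiegel, §2 (2.10)] -/
theorem logP_eq_pi_div_alpha (hD : 1 ≤ Real.log D) : Real.log (bigP D) = π / alpha D := by
  have hα := (alpha_pos_of_log (D := D) hD).ne'
  have h := alpha_mul_logP (D := D) hD
  field_simp
  linarith

/-- Norms of the numerical literals `0.504, 0.498, 0.5 : ℂ`. [folklore] -/
private theorem norm_lits : ‖(0.504 : ℂ)‖ = 0.504 ∧ ‖(0.498 : ℂ)‖ = 0.498 ∧ ‖(0.5 : ℂ)‖ = 0.5 := by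
  refine ⟨?_, ?_, ?_⟩
  · rw [show (0.504 : ℂ) = ((0.504 : ℝ) : ℂ) by norm_num, Complex.norm_real]; norm_num
  · rw [show (0.498 : ℂ) = ((0.498 : ℝ) : ℂ) by norm_num, Complex.norm_real]; norm_num
  · rw [show (0.5 : ℂ) = ((0.5 : ℝ) : ℂ) by norm_num, Complex.norm_real]; norm_num

/-- **The second main term of u049 is `O(α𝔞)`** uniformly in `D`:
`‖main‖ ≤ 𝔞α · 7W(‖ι₃‖·0.002/(0.504·0.498) + ‖ι₄‖·0.004/(0.504·0.5))/π`. [cite: Zhang2022LandauSiegel, §12 (12.16) p.73] -/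
theorem norm_main12u049int_le (hD : 1 ≤ Real.log D) {j : ℕ} (hj : j ∈ ({1, 2, 3} : Finset ℕ)) :
    ‖main12u049int c' χ j‖ ≤ frakA χ * alpha D *
      (7 * (1 + (6 + 15 * |c'| * π) * (521 * π)) *
        (‖iota3‖ * 0.002 / (0.504 * 0.498) + ‖iota4‖ * 0.004 / (0.504 * 0.5)) / π) := by
  obtain ⟨h6, h7⟩ := norm_int049_le c' (D := D) hD hj
  obtain ⟨n504, n498, n5⟩ := norm_lits
  have hA := frakA_nonneg χ
  have hπ := Real.pi_pos
  have hα := alpha_pos_of_log (D := D) hD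
  have hlogpos : 0 < Real.log (bigP D) := by rw [logP_eq_pi_div_alpha hD]; positivity
  have hW : 0 ≤ 1 + (6 + 15 * |c'| * π) * (521 * π) := by positivity
  set W := 1 + (6 + 15 * |c'| * π) * (521 * π)
  set I6 := ∫ z in (0.496:ℝ)..0.498, ghj j 6 (0.498 - z) * frakwStar0 c' D j (bigP D ^ z)
  set I7 := ∫ z in (0.496:ℝ)..0.5, ghj j 7 (0.5 - z) * frakwStar0 c' D j (bigP D ^ z)
  have e1 : ‖(frakA χ : ℂ) * iota3 / (0.504 * 0.498 * (Real.log (bigP D) : ℂ)) * I6‖ =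
      frakA χ * ‖iota3‖ / (0.504 * 0.498 * Real.log (bigP D)) * ‖I6‖ := by
    rw [norm_mul, norm_div, norm_mul, norm_mul, norm_mul, Complex.norm_real, Complex.norm_real,
      Real.norm_of_nonneg hA, Real.norm_of_nonneg hlogpos.le, n504, n498]
  have e2 : ‖(frakA χ : ℂ) * iota4 / (0.504 * 0.5 * (Real.log (bigP D) : ℂ)) * I7‖ =
      frakA χ * ‖iota4‖ / (0.504 * 0.5 * Real.log (bigP D)) * ‖I7‖ := by
    rw [norm_mul, norm_div, norm_mul, norm_mul, norm_mul, Complex.norm_real, Complex.norm_real,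
      Real.norm_of_nonneg hA, Real.norm_of_nonneg hlogpos.le, n504, n5]
  rw [main12u049int]
  calc ‖(frakA χ : ℂ) * iota3 / (0.504 * 0.498 * (Real.log (bigP D) : ℂ)) * I6 +
        (frakA χ : ℂ) * iota4 / (0.504 * 0.5 * (Real.log (bigP D) : ℂ)) * I7‖
      ≤ ‖(frakA χ : ℂ) * iota3 / (0.504 * 0.498 * (Real.log (bigP D) : ℂ)) * I6‖ +
        ‖(frakA χ : ℂ) * iota4 / (0.504 * 0.5 * (Real.log (bigP D) : ℂ)) * I7‖ := norm_add_le _ _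
    _ = frakA χ * ‖iota3‖ / (0.504 * 0.498 * Real.log (bigP D)) * ‖I6‖ +
        frakA χ * ‖iota4‖ / (0.504 * 0.5 * Real.log (bigP D)) * ‖I7‖ := by rw [e1, e2]
    _ ≤ frakA χ * ‖iota3‖ / (0.504 * 0.498 * Real.log (bigP D)) * (7 * W * 0.002) +
        frakA χ * ‖iota4‖ / (0.504 * 0.5 * Real.log (bigP D)) * (7 * W * 0.004) := by
        gcongr
    _ = frakA χ * alpha D *
        (7 * W * (‖iota3‖ * 0.002 / (0.504 * 0.498) + ‖iota4‖ * 0.004 / (0.504 * 0.5)) / π) := by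
        rw [logP_eq_pi_div_alpha hD]
        field_simp

/-- **The slack carrier of u049 is `O(α𝔞)`**: `maj ≤ 𝔞α·7(‖ι₃‖·0.002/(0.504·0.498) + ‖ι₄‖·0.004/(0.504·0.5))/π`.
[cite: Zhang2022LandauSiegel, §12 (12.16) p.73] -/
theorem maj12u049int_le (hD : 1 ≤ Real.log D) {j : ℕ} (hj : j ∈ ({1, 2, 3} : Finset ℕ)) :
    maj12u049int χ j ≤ frakA χ * alpha D *
      (7 * (‖iota3‖ * 0.002 / (0.504 * 0.498) + ‖iota4‖ * 0.004 / (0.504 * 0.5)) / π) := by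
  obtain ⟨h6, h7⟩ := int_norm_ghj_le (j := j) hj
  have hA := frakA_nonneg χ
  have hπ := Real.pi_pos
  have hα := alpha_pos_of_log (D := D) hD
  have hlogpos : 0 < Real.log (bigP D) := by rw [logP_eq_pi_div_alpha hD]; positivity
  rw [maj12u049int]
  calc frakA χ * ‖iota3‖ / (0.504 * 0.498 * Real.log (bigP D)) *
          (∫ z in (0.496:ℝ)..0.498, ‖ghj j 6 (0.498 - z)‖) +
        frakA χ * ‖iota4‖ / (0.504 * 0.5 * Real.log (bigP D)) *
          (∫ z in (0.496:ℝ)..0.5, ‖ghj j 7 (0.5 - z)‖)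
      ≤ frakA χ * ‖iota3‖ / (0.504 * 0.498 * Real.log (bigP D)) * (7 * 0.002) +
        frakA χ * ‖iota4‖ / (0.504 * 0.5 * Real.log (bigP D)) * (7 * 0.004) := by
        gcongr
    _ = frakA χ * alpha D *
        (7 * (‖iota3‖ * 0.002 / (0.504 * 0.498) + ‖iota4‖ * 0.004 / (0.504 * 0.5)) / π) := by
        rw [logP_eq_pi_div_alpha hD]
        field_simp

/-- **`S_j(𝐚₁₅,𝐚₂₂) = O(α𝔞) + O(α)`** from "first sum `o(α)`" and u049 (second form) at `ε = 1`:
`‖S_j‖ ≤ α(𝔞K₅ + 2)`. [cite: Zhang2022LandauSiegel, §12 (12.16) p.73] -/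
theorem norm_Sj_a15_le (hD : 4 ≤ Real.log D) {j : ℕ} (hj : j ∈ ({1, 2, 3} : Finset ℕ)) (a15 : ℕ → ℂ)
    (hBot : ‖SjOn c' D j a15 (a22 χ) (rngBot D)‖ ≤ 1 * alpha D)
    (hTop : ‖SjOn c' D j a15 (a22 χ) (rngTop D) - main12u049int c' χ j‖ ≤
      1e-5 * maj12u049int χ j + 1 * alpha D) :
    ‖Sj c' D j a15 (a22 χ)‖ ≤ alpha D * (frakA χ *
      ((7 * (1 + (6 + 15 * |c'| * π) * (521 * π)) + 1e-5 * 7) *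
        (‖iota3‖ * 0.002 / (0.504 * 0.498) + ‖iota4‖ * 0.004 / (0.504 * 0.5)) / π) + 2) := by
  have hD1 : 1 ≤ Real.log D := by linarith
  have hm := norm_main12u049int_le c' χ hD1 hj
  have hM := maj12u049int_le χ hD1 hj
  rw [Sj_a15_split c' χ hD j a15]
  set B := SjOn c' D j a15 (a22 χ) (rngBot D)
  set T := SjOn c' D j a15 (a22 χ) (rngTop D)
  set m := main12u049int c' χ j
  have k2 : ‖T‖ ≤ ‖T - m‖ + ‖m‖ := by have := norm_sub_norm_le T m; linarith
  have key : ‖B + T‖ ≤ ‖B‖ + (‖T - m‖ + ‖m‖) := (norm_add_le _ _).trans (by linarith)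
  have hπ := Real.pi_pos
  have hA := frakA_nonneg χ
  have hα := (alpha_pos_of_log hD1).le
  set c₀ := ‖iota3‖ * 0.002 / (0.504 * 0.498) + ‖iota4‖ * 0.004 / (0.504 * 0.5)
  set W := 1 + (6 + 15 * |c'| * π) * (521 * π)
  have e : alpha D * (frakA χ * ((7 * W + 1e-5 * 7) * c₀ / π) + 2) =
      2 * alpha D + 1e-5 * (frakA χ * alpha D * (7 * c₀ / π)) + frakA χ * alpha D * (7 * W * c₀ / π) := by
    field_simp
    ring
  rw [e]
  nlinarith [key, hBot, hTop, hm, hM, k2]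

/-- **The error term of Proposition 7.1 at `(𝐚₁₅,𝐚₂₂)` is negligible: `E(𝐚₁₅,𝐚₂₂) = o(𝔓)`** — the
TACIT input of "by Proposition 7.1" for the second mean value of (12.9), DERIVED from the typed p. 73
range claims ("first sum `o(α)`", u049), `𝔞 ≪ 𝓛⁴` and `α𝓛² = π𝓛⁻⁷`.
[cite: Zhang2022LandauSiegel, §12 (12.17) p.73; §7 Prop. 7.1] -/
theorem ecal_a15_small (hLow : Low1522 c') (h049 : Step12u049 c') :
    ∀ ε : ℝ, 0 < ε → ForAllLarge fun D _ χ => AssumptionA D χ →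
      Ecal c' D (a15 χ) (a22 χ) ≤ ε * frakP D := by
  intro ε hε
  set c₀ := ‖iota3‖ * 0.002 / (0.504 * 0.498) + ‖iota4‖ * 0.004 / (0.504 * 0.5) with hc₀
  set W := 1 + (6 + 15 * |c'| * π) * (521 * π) with hW
  set K5 := (7 * W + 1e-5 * 7) * c₀ / π with hK5
  set K := 3 * K5 with hK
  set A₀ : ℝ := 96 * Real.exp 9 / π ^ 2 with hA₀
  have hπ := Real.pi_pos
  have hW0 : 0 ≤ W := by positivity
  have hc0 : 0 ≤ c₀ := by positivity
  have hK50 : 0 ≤ K5 := by positivity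
  have hK0 : 0 ≤ K := by positivity
  have hA₀0 : 0 ≤ A₀ := by positivity
  obtain ⟨D₀, hall⟩ := ((hLow 1 one_pos).and (h049 1 one_pos)).and
    (forAllLarge_log_ge (max 4 (π * (A₀ * K + 9) / ε)))
  refine ⟨D₀, fun D _ χ hD hq hp hA => ?_⟩
  obtain ⟨⟨eLow, e049⟩, hlog⟩ := hall D χ hD hq hp
  have hlog4 : 4 ≤ Real.log D := le_trans (le_max_left _ _) hlog
  have hlogb : π * (A₀ * K + 9) / ε ≤ Real.log D := le_trans (le_max_right _ _) hlog
  have hD1 : 1 ≤ Real.log D := by linarith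
  have ha15 : ∀ n, a15 χ n = χ (n : ZMod D) * vk13 D n := fun n => rfl
  have hS : ∀ j ∈ ({1, 2, 3} : Finset ℕ), ‖Sj c' D j (a15 χ) (a22 χ)‖ ≤
      alpha D * (frakA χ * K5 + 2) := by
    intro j hj
    have h1 := eLow hA (a15 χ) ha15 j hj
    have h2 := (e049 hA (a15 χ) ha15 j hj).2
    exact norm_Sj_a15_le c' χ hlog4 hj (a15 χ) h1 h2
  have hS1 := hS 1 (by simp)
  have hS2 := hS 2 (by simp)
  have hS3 := hS 3 (by simp)
  have hP := frakP_nonneg D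
  have hAf := frakA_nonneg χ
  have hα := (alpha_pos_of_log hD1).le
  have hℓ1 : 1 ≤ ell D := by rw [ell]; exact hD1
  have hsum : ‖Sj c' D 1 (a15 χ) (a22 χ)‖ + ‖Sj c' D 2 (a15 χ) (a22 χ)‖ + ‖Sj c' D 3 (a15 χ) (a22 χ)‖
      ≤ alpha D * (frakA χ * K + 9) := by
    rw [hK]; nlinarith
  have hαℓ : alpha D * ell D ^ 2 = π / ell D ^ 7 := by
    have hℓ0 : ell D ≠ 0 := by linarith
    rw [Section2.alpha_eq_pi_div_ell9]; field_simp
  have hsmall : π / ell D ^ 7 * (frakA χ * K + 9) ≤ ε :=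
    small_of_log_large hℓ1 hK0 hA₀0 (frakA_le_ell_pow_four χ (by linarith) hp) hε
      (by rw [ell]; exact hlogb)
  rw [Ecal]
  calc frakP D * ell D ^ 2 *
        (‖Sj c' D 1 (a15 χ) (a22 χ)‖ + ‖Sj c' D 2 (a15 χ) (a22 χ)‖ + ‖Sj c' D 3 (a15 χ) (a22 χ)‖)
      ≤ frakP D * ell D ^ 2 * (alpha D * (frakA χ * K + 9)) := by gcongr
    _ = frakP D * (π / ell D ^ 7 * (frakA χ * K + 9)) := by rw [← hαℓ]; ring
    _ ≤ frakP D * ε := by gcongr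
    _ = ε * frakP D := by ring

end SizeA15b

end Literature.NumberTheory.LFunctions.Zhang2022.Sec12D
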